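import Summits.BirchSwinnertonDyer.BirchSwinnertonDyer.Theorems.GenusKolyvaginAtTwoShaCardDvdPowAtTwoRTKolyvaginDescentAtTransposition
import Literature.NumberTheory.EllipticCurves.ArchimedeanLocalConditionTorsion
import HarnessLib

/-!
# Route `GenusKolyvaginAtTwo`, crux U⁺_T `ShaCardDvdPowAtTwoPosT` (stmt-BirchSwinnertonDyer-23378; `Δ(E) > 0`, upper half
# `#Ш(E/K)[2^∞] ∣ 2^(2M₀)`) — THE ARCHIMEDEAN BIT OF THE ℚ-DESCENDED KOLYVAGIN CLASS IS FREE AT MARGIN ONE, FOR EITHER SIGN OF `Δ`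

Seat `bsd-line-gk2-p5` g31 (WIDTH-5 attach, cell `bsd-f1-sign2`), `--supports stmt-BirchSwinnertonDyer-23378 --as helper` (closes nothing).
THEOREMS ONLY (no definition, no named fact, no `sorry`).  BSD is NOT proved by any of this; neither is U⁺_T, U_T, Q4_T nor any stub.

WHY.  LINE 19's ℚ-side sharp exponent (B2Q, `…RTSharpExponentRat.two_pow_smul_selmer_rat_eq_zero_onHabitat`, gk2-p4 g22) runs Kolyvagin's
layer one OVER `ℚ`; of its four uses of `Δ < 0` (gk2-p4 g23, STATUS 2026-08-30T00:08Z (b)) the archimedean one is the membership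
`u ∈ selmerLocalKer W ℚ_∞ (2^M)` of the ℚ-descent `u` of the `τ`-invariant Kolyvagin class `c_M(ℓ)` (there: `ArchVanishing.…_of_Δ_neg`,
`H¹(ℝ, E[2^M]) = 0`).  On `Δ > 0`, `H¹(ℝ, E[2^M]) ≅ (ℤ/2)²` and the real Selmer line has index `2`, so a DIRECT port loses one bit
(`2^{M₀+1}·Sel = 0`).  This file shows the bit is FREE whenever the Kolyvagin primes have MARGIN ONE (index `≥ M + 1`) — which B2Q already
pays for its Čebotarev step: by McCallum's Lemma 4.6 `ι_* c_M(n) = 2 • c_{M+1}(n)` (tree `torsionH1OfDvd_kolyvaginClass_pow`), so the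
ℚ-descents satisfy `ι_* u_M = 2 • u_{M+1}` (`res` injective, `E(K)[2^{M+1}] = 0`), and `H¹(K_w, E)` is `2`-torsion at every infinite place
(tree `two_nsmul_mem_selmerLocalKer_infinitePlace`, Serre I §2.4); the change of level `ι_*` reflects the local condition
(`torsionH1OfDvd_mem_selmerLocalKer_iff`).  No Heegner-point geometry, no identity-component datum, no sign of `Δ`.

WHAT (namespace `…Theorems.GenusExact.SelmerDescent`, next to this lineage's `…RTLevelDescent` / `…RTDescentAtTransposition` /
`…RTKolyvaginDescentAtTransposition`, whose global forms carried `Δ(E) < 0` ONLY for the infinite place):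
* §1 (any number field `F`, any levels `d ∣ n`, any class) `mem_selmerLocalKer_infinitePlace_of_torsionH1OfDvd_eq_two_zsmul`:
  `ι_* u_d = 2 • u_n ⟹ u_d ∈ selmerLocalKer W F_w d` for every infinite place `w`; and the displayed form
  `mem_selmerLocalKer_infinitePlace_of_resTorsion_level` (`res u_d = c_d`, `res u_n = c_n`, `ι_* c_d = 2 • c_n`, `res` injective).
* §2 (`K/ℚ` quadratic, both members) the SIGN-FREE global forms of p743025/p743217:
  `mem_selmerGroup_of_torsionH1OfDvd_eq_two_zsmul_signFree`, `mem_selmerGroup_of_resTorsion_level_signFree` (member `E`),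
  `mem_selmerGroup_twin_of_torsionH1OfDvd_eq_two_zsmul_signFree`, `mem_selmerGroup_twin_of_resTorsion_level_signFree` (twin `E^{(c)}`) —
  the hypotheses `Δ(E) < 0` / `c ≠ 0` of the originals DELETED.
* §3 (the route's Kolyvagin classes, margin one) `mem_selmerLocalKer_infinitePlace_of_resTorsion_eq_kolyvaginClass_two_of_margin` (sign `+`:
  ANY ℚ-descent `u` of `c_M(n)` is Selmer at `∞` once `c_{M+1}(n)` is `τ`-invariant) and
  `mem_selmerLocalKer_infinitePlace_twin_of_hPsiKT_resTorsion_eq_kolyvaginClass_two_of_margin` (sign `−`, twin member).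

CONSEQUENCE (not proved here): in the `Δ > 0` port of B2Q at a REGULAR Kolyvagin prime (sibling engine `OffBigImageOddLocalAtTwo.Engine`:
`lemma_5_3_rat_two_regular`, `zsmul_mem_torsionLocalKer_iff_resTorsion_of_notMem_regular`) the archimedean input `huinf` is §3 verbatim, so the
exponent stays SHARP (`2^{M₀}`, not `2^{M₀+1}`); the one remaining `Δ < 0` input is the signed pair-Čebotarev at a regular prime.

References: [McCallumLMS1991] §4 Lemma 4.3, Lemma 4.6, §5 Lemma 5.3; [Kolyvagin1989Izv] §3; [GrossLMS1991] §6 (proof of Prop. 6.2 (1));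
[SerreGaloisCohomology1997] I §2.4 (Cor. to Prop. 9); [MilneADT2006] I Rem. 3.7.
-/

set_option autoImplicit false
set_option linter.dupNamespace false -- tree convention: `Summit.BirchSwinnertonDyer.BirchSwinnertonDyer.Theorems` (summit = sub-problem)

noncomputable section

open scoped Classical

universe u

namespace Summit.BirchSwinnertonDyer.BirchSwinnertonDyer.Theorems.GenusExact.SelmerDescent

open WeierstrassCurve NumberField IsDedekindDomain Field
open Literature.NumberTheory.EllipticCurves Literature.NumberTheory.EllipticCurves.ModularForms
  Literature.NumberTheory.GaloisRepresentations Literature.NumberTheory.EllipticCurves.KolyvaginCocycle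
open Summit.BirchSwinnertonDyer.Rank1Residual.X11b
open Summit.BirchSwinnertonDyer.BirchSwinnertonDyer.Theorems.GenusExact
open Summit.BirchSwinnertonDyer.BirchSwinnertonDyer.Theorems.GenusExact.EigenClassesFinite
open Summit.BirchSwinnertonDyer.BirchSwinnertonDyer.Theorems.GenusExact.PlusDescent
open Summit.BirchSwinnertonDyer.BirchSwinnertonDyer.Theorems.GenusExact.VisiblePairAtTwo

/-! ## §1 Any number field: one level down, the infinite places carry no condition -/

section General

variable {F : Type} [Field F] [NumberField F] (W : WeierstrassCurve F)

/-- **THE ARCHIMEDEAN BIT IS FREE ONE LEVEL DOWN.**  `F` any number field, `w` any infinite place, levels `d ∣ n` (any), `ι_* : H¹(F, E[d]) →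
H¹(F, E[n])` (`torsionH1OfDvd`).  If `ι_* u_d = 2 • u_n` for SOME `u_n`, then `u_d` satisfies the level-`d` Selmer condition at `w`:
`2 • u_n` is Selmer at `w` because `H¹(F_w, E)` is killed by `2` (`two_nsmul_mem_selmerLocalKer_infinitePlace`), and `ι_*` reflects the local
condition (`torsionH1OfDvd_mem_selmerLocalKer_iff`). [cite: SerreGaloisCohomology1997, I §2.4 (Cor. to Prop. 9)] [cite: McCallumLMS1991, §4 Lemma 4.6] -/
theorem mem_selmerLocalKer_infinitePlace_of_torsionH1OfDvd_eq_two_zsmul {d n : ℤ} (hdn : d ∣ n)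
    {ud : galH1Torsion W d} {un : galH1Torsion W n} (hι : torsionH1OfDvd W hdn ud = (2 : ℤ) • un) (w : InfinitePlace F) :
    ud ∈ selmerLocalKer W w.Completion d := by
  have h : (2 : ℤ) • un ∈ selmerLocalKer W w.Completion n := by
    rw [two_zsmul, ← two_nsmul]
    exact two_nsmul_mem_selmerLocalKer_infinitePlace W n w un
  rw [← hι] at h
  exact (torsionH1OfDvd_mem_selmerLocalKer_iff W w.Completion hdn ud).mpr h

/-- **Global form over any number field**: `ι_* u_d = 2 • u_n` and `u_d` Selmer at every FINITE place ⟹ `u_d ∈ Sel^{(d)}(E/F)` — the infinite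
places come for free. [cite: SerreGaloisCohomology1997, I §2.4 (Cor. to Prop. 9)] -/
theorem mem_selmerGroup_of_torsionH1OfDvd_eq_two_zsmul_of_forall_finite {d n : ℤ} (hdn : d ∣ n)
    {ud : galH1Torsion W d} {un : galH1Torsion W n} (hι : torsionH1OfDvd W hdn ud = (2 : ℤ) • un)
    (hfin : ∀ v : HeightOneSpectrum (𝓞 F), ud ∈ selmerLocalKer W (v.adicCompletion F) d) :
    ud ∈ selmerGroup W d := by
  rw [mem_selmerGroup_iff]
  exact ⟨hfin, fun w ↦ mem_selmerLocalKer_infinitePlace_of_torsionH1OfDvd_eq_two_zsmul W hdn hι w⟩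

variable (L : Type) [Field L] [Algebra F L]

/-- **Displayed form** (the shape of this lineage's `mem_selmerLocalKer_of_resTorsion_level`, at an INFINITE place, with NO hypothesis on the
extension `L/F` beyond injectivity of `res` at level `n`): `res u_d = c_d`, `res u_n = c_n`, `ι_* c_d = 2 • c_n` over `L` ⟹ `u_d` is Selmer at
every infinite place of `F`. [cite: McCallumLMS1991, §4 Lemma 4.6] [cite: SerreGaloisCohomology1997, I §2.4] -/
theorem mem_selmerLocalKer_infinitePlace_of_resTorsion_level {d n : ℤ} (hdn : d ∣ n)
    (hinj : Function.Injective (resTorsion W L n))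
    {ud : galH1Torsion W d} {un : galH1Torsion W n} {cd : galH1Torsion (W.baseChange L) d} {cn : galH1Torsion (W.baseChange L) n}
    (hud : resTorsion W L d ud = cd) (hun : resTorsion W L n un = cn) (hlev : torsionH1OfDvd (W.baseChange L) hdn cd = (2 : ℤ) • cn)
    (w : InfinitePlace F) : ud ∈ selmerLocalKer W w.Completion d := by
  have hι : torsionH1OfDvd W hdn ud = (2 : ℤ) • un :=
    hinj (by rw [resTorsion_torsionH1OfDvd, hud, hlev, map_zsmul, hun])
  exact mem_selmerLocalKer_infinitePlace_of_torsionH1OfDvd_eq_two_zsmul W hdn hι w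

end General

/-! ## §2 Over `ℚ` with `K` quadratic: the SIGN-FREE global forms (the `Δ(E) < 0` hypothesis of p743025 / p743217 deleted) -/

section Rat

variable {K : Type} [Field K] [NumberField K] (W : WeierstrassCurve ℚ)

/-- **Member `E`, global, ANY sign of `Δ(E)`**: `ι_* u_d = 2 • u_n`, `res u_n ∈ Sel^{(n)}(E_K/K) ⟹ u_d ∈ Sel^{(d)}(E/ℚ)` (finite places by this
lineage's `…_of_K`, the infinite place by §1).  Twin of `mem_selmerGroup_of_torsionH1OfDvd_eq_two_zsmul` without `Δ(E) < 0`.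
[cite: McCallumLMS1991, §4 Lemma 4.3 and Lemma 4.6] [cite: Kolyvagin1989Izv, §3] [cite: SerreGaloisCohomology1997, I §2.4] -/
theorem mem_selmerGroup_of_torsionH1OfDvd_eq_two_zsmul_signFree (h2 : Module.finrank ℚ K = 2)
    {d n : ℤ} (hdn : d ∣ n) {ud : galH1Torsion W d} {un : galH1Torsion W n} (hι : torsionH1OfDvd W hdn ud = (2 : ℤ) • un)
    (hu : resTorsion W K n un ∈ selmerGroup (W.baseChange K) n) :
    ud ∈ selmerGroup W d := by
  rw [mem_selmerGroup_iff] at hu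
  exact mem_selmerGroup_of_torsionH1OfDvd_eq_two_zsmul_of_forall_finite W hdn hι
    fun v ↦ mem_selmerLocalKer_of_torsionH1OfDvd_eq_two_zsmul_of_K W h2 hdn hι rfl v (fun w _ ↦ hu.1 w)

/-- **Member `E`, global, displayed, ANY sign of `Δ(E)`**: `res u_d = c_d`, `res u_n = c_n`, `ι_* c_d = 2 • c_n`, `res` injective at level `n`,
`c_n ∈ Sel^{(n)}(E_K/K) ⟹ u_d ∈ Sel^{(d)}(E/ℚ)`.  Twin of `mem_selmerGroup_of_resTorsion_level` without `Δ(E) < 0`.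
[cite: McCallumLMS1991, §4 Lemma 4.3 and Lemma 4.6] [cite: Kolyvagin1989Izv, §3] -/
theorem mem_selmerGroup_of_resTorsion_level_signFree (h2 : Module.finrank ℚ K = 2) {d n : ℤ} (hdn : d ∣ n)
    (hinj : Function.Injective (resTorsion W K n))
    {ud : galH1Torsion W d} {un : galH1Torsion W n} {cd : galH1Torsion (W.baseChange K) d} {cn : galH1Torsion (W.baseChange K) n}
    (hud : resTorsion W K d ud = cd) (hun : resTorsion W K n un = cn) (hlev : torsionH1OfDvd (W.baseChange K) hdn cd = (2 : ℤ) • cn)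
    (hsel : cn ∈ selmerGroup (W.baseChange K) n) :
    ud ∈ selmerGroup W d := by
  have hι : torsionH1OfDvd W hdn ud = (2 : ℤ) • un :=
    hinj (by rw [resTorsion_torsionH1OfDvd, hud, hlev, map_zsmul, hun])
  exact mem_selmerGroup_of_torsionH1OfDvd_eq_two_zsmul_signFree W h2 hdn hι (hun ▸ hsel)

/-- **Twin member `E^{(c)}`, global, ANY sign of `Δ(E)`, any `c`** (`K = ℚ(θ)`, `θ² = c`): `ι_* y_d = 2 • y_n` in `H¹(ℚ, E^{(c)}[·])`,
`hPsiKT (res y_n) ∈ Sel^{(n)}(E_K/K) ⟹ y_d ∈ Sel^{(d)}(E^{(c)}/ℚ)`.  Twin of `mem_selmerGroup_twin_of_torsionH1OfDvd_eq_two_zsmul` without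
`Δ(E) < 0`, `c ≠ 0`. [cite: McCallumLMS1991, §4 Lemma 4.3 and Lemma 4.6] [cite: Kolyvagin1989Izv, §3] [cite: SerreGaloisCohomology1997, I §2.4] -/
theorem mem_selmerGroup_twin_of_torsionH1OfDvd_eq_two_zsmul_signFree (h2 : Module.finrank ℚ K = 2) {θ : K} {c : ℚ}
    (hθ : θ ∉ Set.range (algebraMap ℚ K)) (hc : θ ^ 2 = algebraMap ℚ K c)
    {d n : ℤ} (hdn : d ∣ n) {yd : galH1Torsion (W.quadraticTwist c) d} {yn : galH1Torsion (W.quadraticTwist c) n}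
    (hι : torsionH1OfDvd (W.quadraticTwist c) hdn yd = (2 : ℤ) • yn)
    (hy : hPsiKT W K hθ hc n (resTorsion (W.quadraticTwist c) K n yn) ∈ selmerGroup (W.baseChange K) n) :
    yd ∈ selmerGroup (W.quadraticTwist c) d := by
  rw [mem_selmerGroup_iff] at hy
  exact mem_selmerGroup_of_torsionH1OfDvd_eq_two_zsmul_of_forall_finite (W.quadraticTwist c) hdn hι
    fun v ↦ mem_selmerLocalKer_twin_of_torsionH1OfDvd_eq_two_zsmul_of_K W h2 hθ hc hdn hι rfl v (fun w _ ↦ hy.1 w)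

/-- **Twin member, global, displayed, ANY sign of `Δ(E)`**: `hPsiKT (res y_d) = c_d`, `hPsiKT (res y_n) = c_n`, `ι_* c_d = 2 • c_n`,
`res` injective on `H¹(ℚ, E^{(c)}[n])`, `c_n ∈ Sel^{(n)}(E_K/K) ⟹ y_d ∈ Sel^{(d)}(E^{(c)}/ℚ)`.  Twin of `mem_selmerGroup_twin_of_resTorsion_level`
without `Δ(E) < 0`, `c ≠ 0`. [cite: McCallumLMS1991, §4 Lemma 4.3 and Lemma 4.6] [cite: Kolyvagin1989Izv, §3] -/
theorem mem_selmerGroup_twin_of_resTorsion_level_signFree (h2 : Module.finrank ℚ K = 2) {θ : K} {c : ℚ}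
    (hθ : θ ∉ Set.range (algebraMap ℚ K)) (hc : θ ^ 2 = algebraMap ℚ K c) {d n : ℤ} (hdn : d ∣ n)
    (hinj : Function.Injective (resTorsion (W.quadraticTwist c) K n))
    {yd : galH1Torsion (W.quadraticTwist c) d} {yn : galH1Torsion (W.quadraticTwist c) n}
    {cd : galH1Torsion (W.baseChange K) d} {cn : galH1Torsion (W.baseChange K) n}
    (hyd : hPsiKT W K hθ hc d (resTorsion (W.quadraticTwist c) K d yd) = cd)
    (hyn : hPsiKT W K hθ hc n (resTorsion (W.quadraticTwist c) K n yn) = cn)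
    (hlev : torsionH1OfDvd (W.baseChange K) hdn cd = (2 : ℤ) • cn)
    (hsel : cn ∈ selmerGroup (W.baseChange K) n) :
    yd ∈ selmerGroup (W.quadraticTwist c) d := by
  have hι : torsionH1OfDvd (W.quadraticTwist c) hdn yd = (2 : ℤ) • yn := by
    apply hinj
    apply (hPsiKT W K hθ hc n).injective
    rw [resTorsion_torsionH1OfDvd, hPsiKT_torsionH1OfDvd, hyd, hlev, map_zsmul, map_zsmul, hyn]
  exact mem_selmerGroup_twin_of_torsionH1OfDvd_eq_two_zsmul_signFree W h2 hθ hc hdn hι (hyn ▸ hsel)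

/-- **Twin member, one infinite place, displayed**: `hPsiKT (res y_d) = c_d`, `hPsiKT (res y_n) = c_n`, `ι_* c_d = 2 • c_n`, `res` injective on
`H¹(ℚ, E^{(c)}[n])` ⟹ `y_d` is Selmer at every infinite place of `ℚ` (no condition on `c_n`). [cite: McCallumLMS1991, §4 Lemma 4.6]
[cite: SerreGaloisCohomology1997, I §2.4] -/
theorem mem_selmerLocalKer_infinitePlace_twin_of_resTorsion_level {θ : K} {c : ℚ}
    (hθ : θ ∉ Set.range (algebraMap ℚ K)) (hc : θ ^ 2 = algebraMap ℚ K c) {d n : ℤ} (hdn : d ∣ n)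
    (hinj : Function.Injective (resTorsion (W.quadraticTwist c) K n))
    {yd : galH1Torsion (W.quadraticTwist c) d} {yn : galH1Torsion (W.quadraticTwist c) n}
    {cd : galH1Torsion (W.baseChange K) d} {cn : galH1Torsion (W.baseChange K) n}
    (hyd : hPsiKT W K hθ hc d (resTorsion (W.quadraticTwist c) K d yd) = cd)
    (hyn : hPsiKT W K hθ hc n (resTorsion (W.quadraticTwist c) K n yn) = cn)
    (hlev : torsionH1OfDvd (W.baseChange K) hdn cd = (2 : ℤ) • cn) (w : InfinitePlace ℚ) :
    yd ∈ selmerLocalKer (W.quadraticTwist c) w.Completion d := by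
  have hι : torsionH1OfDvd (W.quadraticTwist c) hdn yd = (2 : ℤ) • yn := by
    apply hinj
    apply (hPsiKT W K hθ hc n).injective
    rw [resTorsion_torsionH1OfDvd, hPsiKT_torsionH1OfDvd, hyd, hlev, map_zsmul, map_zsmul, hyn]
  exact mem_selmerLocalKer_infinitePlace_of_torsionH1OfDvd_eq_two_zsmul (W.quadraticTwist c) hdn hι w

end Rat

/-! ## §3 The route's Kolyvagin classes with margin one: the ℚ-descent of `c_M(n)` is Selmer at `∞`, either sign, any sign of `Δ` -/

section Kolyvagin

variable {K : Type} [Field K] [NumberField K]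

/-- **THE ARCHIMEDEAN BIT FOR KOLYVAGIN'S CLASSES, sign `+` (member `E`).**  Frame: `E/ℚ` globally minimal, `ρ_{E,2^k}` onto for all `k`;
`K = ℚ(θ)` imaginary quadratic (`θ² = c`), `d_K ∉ {−3, −4}`, Heegner hypothesis for `N_E`, `E(K)[2^(M+1)] = 0` (`hL`; true for `ρ̄_{E,2}` onto);
`(Dt, β, ι)`, `n` square-free of Zhang–Kolyvagin primes at `2` of index `≥ M + 1` (MARGIN ONE), a datum `d`, and the level-`(M+1)` class
`c_{M+1}(n)` `τ`-INVARIANT (`τ = σ₀`; parity `−w(E)·(−1)^{#primes} = +1`, `sign_conjAct_kolyvaginClass_two`).  Then EVERY `u ∈ H¹(ℚ, E[2^M])` with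
`res u = c_M(n)` is SELMER AT EVERY INFINITE PLACE of `ℚ` — whatever the sign of `Δ(E)`.  (`Δ < 0`: vacuous, `ArchVanishing`; `Δ > 0`: the bit a
direct port of B2Q would lose.)  Proof: `ι_* c_M = 2 • c_{M+1}` (McCallum Lemma 4.6, standing inputs at level `M+1` from
`isAdmissible_pointsSubgroup_two_of_heegner` and `Prop44.toGeomPoints_derivedPoint_mem_invPoints`), the ℚ-descent `u_{M+1}` of `c_{M+1}`
(`existsUnique_resTorsion_eq_of_conjAct_eq`), `res` injective at level `M+1`, then §1.  NO Gross 6.2, NO odd-Tamagawa, NO `Δ` hypothesis.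
[cite: McCallumLMS1991, §4 Lemma 4.3, Lemma 4.6] [cite: GrossLMS1991, Prop. 3.6, §4 Lemma 4.3] [cite: SerreGaloisCohomology1997, I §2.4 (Cor. to Prop. 9)] -/
theorem mem_selmerLocalKer_infinitePlace_of_resTorsion_eq_kolyvaginClass_two_of_margin
    (W : WeierstrassCurve ℚ) [W.IsElliptic] [W.IsGloballyMinimal] [NeZero (W.conductorNorm ℤ)]
    (hsurj : ∀ k : ℕ, W.HasSurjectiveModNGaloisRep ((2 ^ k : ℕ) : ℤ))
    (K : Type) [Field K] [NumberField K] (hK : IsImaginaryQuadratic K) (h2 : Module.finrank ℚ K = 2)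
    {θ : K} {c : ℚ} (hθ : θ ∉ Set.range (algebraMap ℚ K)) (hc : θ ^ 2 = algebraMap ℚ K c)
    (hD3 : NumberField.discr K ≠ -3) (hD4 : NumberField.discr K ≠ -4)
    (hH : SatisfiesHeegnerHypothesis (W.conductorNorm ℤ) K)
    (Dt : ModularParametrizationData W (W.conductorNorm ℤ)) (β : ℤ) (ι : K →+* ℂ) (M : ℕ)
    {n : ℕ} (hn : Squarefree n)
    (hk : ∀ q ∈ n.primeFactors, Zhang2014.IsKolyvaginPrime (W.conductorNorm ℤ) W K 2 q ∧ M + 1 ≤ Zhang2014.kolyvaginIndex W 2 q)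
    (d : KolyvaginHeegnerData Dt β ι n)
    (hL : ∀ P : (W.baseChange K).toAffine.Point, ((2 ^ (M + 1) : ℕ) : ℤ) • P = 0 → P = 0)
    (hfix1 : conjAct W (sigmaQ K h2 hθ hc) ((2 ^ (M + 1) : ℕ) : ℤ) (d.kolyvaginClass Nat.prime_two (M + 1)) =
      d.kolyvaginClass Nat.prime_two (M + 1))
    {u : galH1Torsion W ((2 ^ M : ℕ) : ℤ)} (hu : resTorsion W K ((2 ^ M : ℕ) : ℤ) u = d.kolyvaginClass Nat.prime_two M)
    (w : InfinitePlace ℚ) :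
    u ∈ selmerLocalKer W w.Completion ((2 ^ M : ℕ) : ℤ) := by
  have hn0 : n ≠ 0 := hn.ne_zero
  have hD : NumberField.discr K < -4 := KolyvaginAssembly.discr_lt_neg_four hK ⟨hD3, hD4⟩
  -- McCallum's standing inputs at level `M + 1`
  have hA1 : IsAdmissible (absoluteGaloisGroup K) d.pointsSubgroup ((2 ^ (M + 1) : ℕ) : ℤ) :=
    isAdmissible_pointsSubgroup_two_of_heegner d hK hn0 hD4 hH hsurj (M + 1)
  have hPt1 : d.toGeomPoints d.derivedPoint ∈ invPoints (absoluteGaloisGroup K) d.pointsSubgroup ((2 ^ (M + 1) : ℕ) : ℤ) :=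
    Prop44.toGeomPoints_derivedPoint_mem_invPoints hK ι hD hH Dt Nat.prime_two hn hk d
  -- Lemma 4.6: `ι_* c_M = 2 • c_{M+1}`
  have hlev := torsionH1OfDvd_kolyvaginClass_pow d Nat.prime_two (Nat.le_succ M) hA1 hPt1
  have h21 : ((2 ^ (M + 1 - M) : ℕ) : ℤ) = 2 := by
    rw [Nat.add_sub_cancel_left, pow_one]; norm_num
  rw [h21] at hlev
  -- the ℚ-descent one level up and injectivity of `res` there
  obtain ⟨u1, hu1, -⟩ := existsUnique_resTorsion_eq_of_conjAct_eq W K h2 hθ hc ((2 ^ (M + 1) : ℕ) : ℤ) hL hfix1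
  have hinj := resTorsion_injective_of_noTorsion W K h2 hθ hc ((2 ^ (M + 1) : ℕ) : ℤ) hL
  exact mem_selmerLocalKer_infinitePlace_of_resTorsion_level W K _ hinj hu hu1 hlev w

/-- **Existential form, sign `+`** (the shape of `exists_descent_kolyvaginClass_two_mem_selmerLocalKer_of_margin`, at the infinite places, WITHOUT
the odd-Tamagawa input): with `c_M(n)` also `τ`-invariant, its ℚ-descent EXISTS and is Selmer at every infinite place of `ℚ`.
[cite: McCallumLMS1991, §4 Lemma 4.3, Lemma 4.6] [cite: SerreGaloisCohomology1997, I §2.4] -/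
theorem exists_descent_kolyvaginClass_two_mem_selmerLocalKer_infinitePlace_of_margin
    (W : WeierstrassCurve ℚ) [W.IsElliptic] [W.IsGloballyMinimal] [NeZero (W.conductorNorm ℤ)]
    (hsurj : ∀ k : ℕ, W.HasSurjectiveModNGaloisRep ((2 ^ k : ℕ) : ℤ))
    (K : Type) [Field K] [NumberField K] (hK : IsImaginaryQuadratic K) (h2 : Module.finrank ℚ K = 2)
    {θ : K} {c : ℚ} (hθ : θ ∉ Set.range (algebraMap ℚ K)) (hc : θ ^ 2 = algebraMap ℚ K c)
    (hD3 : NumberField.discr K ≠ -3) (hD4 : NumberField.discr K ≠ -4)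
    (hH : SatisfiesHeegnerHypothesis (W.conductorNorm ℤ) K)
    (Dt : ModularParametrizationData W (W.conductorNorm ℤ)) (β : ℤ) (ι : K →+* ℂ) (M : ℕ)
    {n : ℕ} (hn : Squarefree n)
    (hk : ∀ q ∈ n.primeFactors, Zhang2014.IsKolyvaginPrime (W.conductorNorm ℤ) W K 2 q ∧ M + 1 ≤ Zhang2014.kolyvaginIndex W 2 q)
    (d : KolyvaginHeegnerData Dt β ι n)
    (hL : ∀ P : (W.baseChange K).toAffine.Point, ((2 ^ (M + 1) : ℕ) : ℤ) • P = 0 → P = 0)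
    (hfix1 : conjAct W (sigmaQ K h2 hθ hc) ((2 ^ (M + 1) : ℕ) : ℤ) (d.kolyvaginClass Nat.prime_two (M + 1)) =
      d.kolyvaginClass Nat.prime_two (M + 1))
    (hfix0 : conjAct W (sigmaQ K h2 hθ hc) ((2 ^ M : ℕ) : ℤ) (d.kolyvaginClass Nat.prime_two M) = d.kolyvaginClass Nat.prime_two M) :
    ∃ u : galH1Torsion W ((2 ^ M : ℕ) : ℤ), resTorsion W K ((2 ^ M : ℕ) : ℤ) u = d.kolyvaginClass Nat.prime_two M ∧
      ∀ w : InfinitePlace ℚ, u ∈ selmerLocalKer W w.Completion ((2 ^ M : ℕ) : ℤ) := by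
  have hLM : ∀ P : (W.baseChange K).toAffine.Point, ((2 ^ M : ℕ) : ℤ) • P = 0 → P = 0 := fun P hP ↦
    hL P (by rw [pow_succ, Nat.cast_mul, mul_comm, mul_smul, hP, smul_zero])
  obtain ⟨u0, hu0, -⟩ := existsUnique_resTorsion_eq_of_conjAct_eq W K h2 hθ hc ((2 ^ M : ℕ) : ℤ) hLM hfix0
  exact ⟨u0, hu0, fun w ↦ mem_selmerLocalKer_infinitePlace_of_resTorsion_eq_kolyvaginClass_two_of_margin W hsurj K hK h2 hθ hc hD3 hD4
    hH Dt β ι M hn hk d hL hfix1 hu0 w⟩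

/-- **THE ARCHIMEDEAN BIT FOR KOLYVAGIN'S CLASSES, sign `−` (twin member `E^{(c)}`, `K = ℚ(√c)`).**  Same frame; the level-`(M+1)` class
`c_{M+1}(n)` ANTI-invariant under `τ`.  Then every twin ℚ-descent `y ∈ H¹(ℚ, E^{(c)}[2^M])` of `c_M(n)` (`hPsiKT (res y) = c_M(n)`) is Selmer
at every infinite place of `ℚ` — whatever the signs of `Δ(E)`, `Δ(E^{(c)})`. [cite: McCallumLMS1991, §4 Lemma 4.3, Lemma 4.6]
[cite: GrossLMS1991, Prop. 3.6, Prop. 5.4] [cite: SerreGaloisCohomology1997, I §2.4 (Cor. to Prop. 9)] -/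
theorem mem_selmerLocalKer_infinitePlace_twin_of_hPsiKT_resTorsion_eq_kolyvaginClass_two_of_margin
    (W : WeierstrassCurve ℚ) [W.IsElliptic] [W.IsGloballyMinimal] [NeZero (W.conductorNorm ℤ)]
    (hsurj : ∀ k : ℕ, W.HasSurjectiveModNGaloisRep ((2 ^ k : ℕ) : ℤ))
    (K : Type) [Field K] [NumberField K] (hK : IsImaginaryQuadratic K) (h2 : Module.finrank ℚ K = 2)
    {θ : K} {c : ℚ} (hθ : θ ∉ Set.range (algebraMap ℚ K)) (hc : θ ^ 2 = algebraMap ℚ K c)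
    (hD3 : NumberField.discr K ≠ -3) (hD4 : NumberField.discr K ≠ -4)
    (hH : SatisfiesHeegnerHypothesis (W.conductorNorm ℤ) K)
    (Dt : ModularParametrizationData W (W.conductorNorm ℤ)) (β : ℤ) (ι : K →+* ℂ) (M : ℕ)
    {n : ℕ} (hn : Squarefree n)
    (hk : ∀ q ∈ n.primeFactors, Zhang2014.IsKolyvaginPrime (W.conductorNorm ℤ) W K 2 q ∧ M + 1 ≤ Zhang2014.kolyvaginIndex W 2 q)
    (d : KolyvaginHeegnerData Dt β ι n)
    (hL : ∀ P : (W.baseChange K).toAffine.Point, ((2 ^ (M + 1) : ℕ) : ℤ) • P = 0 → P = 0)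
    (hneg1 : conjAct W (sigmaQ K h2 hθ hc) ((2 ^ (M + 1) : ℕ) : ℤ) (d.kolyvaginClass Nat.prime_two (M + 1)) =
      -d.kolyvaginClass Nat.prime_two (M + 1))
    {y : galH1Torsion (W.quadraticTwist c) ((2 ^ M : ℕ) : ℤ)}
    (hy : hPsiKT W K hθ hc ((2 ^ M : ℕ) : ℤ) (resTorsion (W.quadraticTwist c) K ((2 ^ M : ℕ) : ℤ) y) = d.kolyvaginClass Nat.prime_two M)
    (w : InfinitePlace ℚ) :
    y ∈ selmerLocalKer (W.quadraticTwist c) w.Completion ((2 ^ M : ℕ) : ℤ) := by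
  have hn0 : n ≠ 0 := hn.ne_zero
  have hD : NumberField.discr K < -4 := KolyvaginAssembly.discr_lt_neg_four hK ⟨hD3, hD4⟩
  have hA1 : IsAdmissible (absoluteGaloisGroup K) d.pointsSubgroup ((2 ^ (M + 1) : ℕ) : ℤ) :=
    isAdmissible_pointsSubgroup_two_of_heegner d hK hn0 hD4 hH hsurj (M + 1)
  have hPt1 : d.toGeomPoints d.derivedPoint ∈ invPoints (absoluteGaloisGroup K) d.pointsSubgroup ((2 ^ (M + 1) : ℕ) : ℤ) :=
    Prop44.toGeomPoints_derivedPoint_mem_invPoints hK ι hD hH Dt Nat.prime_two hn hk d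
  have hlev := torsionH1OfDvd_kolyvaginClass_pow d Nat.prime_two (Nat.le_succ M) hA1 hPt1
  have h21 : ((2 ^ (M + 1 - M) : ℕ) : ℤ) = 2 := by
    rw [Nat.add_sub_cancel_left, pow_one]; norm_num
  rw [h21] at hlev
  obtain ⟨y1, hy1, -⟩ := existsUnique_hPsiKT_resTorsion_eq_of_conjAct_eq_neg W K h2 hθ hc ((2 ^ (M + 1) : ℕ) : ℤ) hL hneg1
  have hinj := resTorsion_twist_injective_of_noTorsion W K h2 hθ hc ((2 ^ (M + 1) : ℕ) : ℤ) hL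
  exact mem_selmerLocalKer_infinitePlace_twin_of_resTorsion_level W hθ hc _ hinj hy hy1 hlev w

end Kolyvagin

end Summit.BirchSwinnertonDyer.BirchSwinnertonDyer.Theorems.GenusExact.SelmerDescent

end
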